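import Summits.KontsevichZagierPeriods.Zeta5Search.Certificates.TwoTaleTelescopeAL
import Summits.KontsevichZagierPeriods.Zeta5Search.Certificates.PolyKronecker6Perm
import HarnessLib

/-!
# ζ(2) two-tale line — (bmiss) certificate, direction `a`, side `L`: a-slices 14–20 of the permuted identity (cell `pub-zeta5`, certifier `cert-2`)

HONEST FRAMING: systematic search; recurrence certificates; no irrationality claim unless certified.

GENERATED by cert-2 g4 `code/gen_a.py`. The cleared identity `QAL` (`TwoTaleTelescopeAL`) is too large for one Kronecker evaluation in the
order `[a,b,e,f,g,t]` (data cost ≈ 126 Gbit of cached intermediates); with `t ↦ v₀` (largest stride) and `a ↦ v₅` (`substs σAT`) each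
`a`-specialisation `a := j` (`substs (σT j)`) is a five-variable identity of volume ≈ 17 Mbit and is checked here by ONE kernel
evaluation (`sliceAL_j`); `TwoTaleTelescopeALFin` assembles the 33 slices (`PolyKronecker6Perm.peval_eq_zero_of_kron6_perm_slices`).
-/

namespace Summit.KontsevichZagierPeriods.Zeta5Search.Certificates

namespace TwoTaleTelescope

open PolyReflect

set_option maxRecDepth 8192 in
set_option maxHeartbeats 40000000 in
/-- Slice `a := 14` of the permuted identity of direction `a`, side `L`, vanishes at its Kronecker point (kernel). -/
theorem sliceAL_14 :
    peval (substs (σT ((14 : ℕ) : ℤ)) (substs σAT QAL)) (kronPoint6 (substs (σT ((14 : ℕ) : ℤ)) (substs σAT QAL))) = 0 := by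
  decide +kernel

set_option maxRecDepth 8192 in
set_option maxHeartbeats 40000000 in
/-- Slice `a := 15` of the permuted identity of direction `a`, side `L`, vanishes at its Kronecker point (kernel). -/
theorem sliceAL_15 :
    peval (substs (σT ((15 : ℕ) : ℤ)) (substs σAT QAL)) (kronPoint6 (substs (σT ((15 : ℕ) : ℤ)) (substs σAT QAL))) = 0 := by
  decide +kernel

set_option maxRecDepth 8192 in
set_option maxHeartbeats 40000000 in
/-- Slice `a := 16` of the permuted identity of direction `a`, side `L`, vanishes at its Kronecker point (kernel). -/
theorem sliceAL_16 :
    peval (substs (σT ((16 : ℕ) : ℤ)) (substs σAT QAL)) (kronPoint6 (substs (σT ((16 : ℕ) : ℤ)) (substs σAT QAL))) = 0 := by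
  decide +kernel

set_option maxRecDepth 8192 in
set_option maxHeartbeats 40000000 in
/-- Slice `a := 17` of the permuted identity of direction `a`, side `L`, vanishes at its Kronecker point (kernel). -/
theorem sliceAL_17 :
    peval (substs (σT ((17 : ℕ) : ℤ)) (substs σAT QAL)) (kronPoint6 (substs (σT ((17 : ℕ) : ℤ)) (substs σAT QAL))) = 0 := by
  decide +kernel

set_option maxRecDepth 8192 in
set_option maxHeartbeats 40000000 in
/-- Slice `a := 18` of the permuted identity of direction `a`, side `L`, vanishes at its Kronecker point (kernel). -/
theorem sliceAL_18 :
    peval (substs (σT ((18 : ℕ) : ℤ)) (substs σAT QAL)) (kronPoint6 (substs (σT ((18 : ℕ) : ℤ)) (substs σAT QAL))) = 0 := by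
  decide +kernel

set_option maxRecDepth 8192 in
set_option maxHeartbeats 40000000 in
/-- Slice `a := 19` of the permuted identity of direction `a`, side `L`, vanishes at its Kronecker point (kernel). -/
theorem sliceAL_19 :
    peval (substs (σT ((19 : ℕ) : ℤ)) (substs σAT QAL)) (kronPoint6 (substs (σT ((19 : ℕ) : ℤ)) (substs σAT QAL))) = 0 := by
  decide +kernel

set_option maxRecDepth 8192 in
set_option maxHeartbeats 40000000 in
/-- Slice `a := 20` of the permuted identity of direction `a`, side `L`, vanishes at its Kronecker point (kernel). -/
theorem sliceAL_20 :
    peval (substs (σT ((20 : ℕ) : ℤ)) (substs σAT QAL)) (kronPoint6 (substs (σT ((20 : ℕ) : ℤ)) (substs σAT QAL))) = 0 := by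
  decide +kernel

end TwoTaleTelescope

end Summit.KontsevichZagierPeriods.Zeta5Search.Certificates
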